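import Literature.NumberTheory.Automorphic.LanglandsTunnellLSeriesProofs
import Literature.NumberTheory.EllipticCurves.Gamma1NewformLSeriesProofs
import Literature.NumberTheory.EllipticCurves.NewformGaloisRepOddProofs
import Literature.NumberTheory.GaloisRepresentations.ArtinRepFrobeniusProofs
import HarnessLib

/-!
# Deligne–Serre 1974, Thm. 4.6 (b) at the primes dividing the level: the target from the
current leaves of its decomposition (pure proofs; companion to
`Literature.NumberTheory.Automorphic.LanglandsTunnellLSeriesProofs`)

The named fact `Literature.NumberTheory.Automorphic.deligneSerre_eulerFactorAt_eq_of_dvd_level`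
(`LanglandsTunnellLSeriesProofs`; Deligne–Serre, *Formes modulaires de poids 1*, Ann. Sci. ÉNS
(4) 7 (1974), Thm. 4.6 (b), p. 514, read off at a prime `p ∣ N`: the Euler factor of the Artin
`L`-function of the representation `ρ` attached to a weight-one newform `f` of level `N` at a
place of residue characteristic `p ∣ N` is `1 - a_p T`) is reduced in that file
(`deligneSerre_eulerFactorAt_eq_of_dvd_level_of_functionalEquations'`) to the four standard
inputs of the printed proof (pp. 515–516, steps (i)–(iv)):

1. (i) the weight-one functional equation `Λ_f(1 - s) = a Λ_{f̃}(s)` of a newform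
   (`DeligneSerre1974.weightOne_functionalEquation`; Hecke, Li 1975 [12], Miyake 1971 [13]);
2. (ii) Artin's functional equation `Λ(1 - s, ρ) = W Λ(s, ρ^∨)`
   (`Lang.artin_functional_equation (K := ℚ)`; Artin 1930 [1]);
3. Rem. 4.5: any finite-image `ρ` attached to `f` is odd (`DeligneSerre1974.rem45_isOdd`);
4. 1.8: `|a_p| ≤ 1` for `p ∣ N` (`IsNewform1.cuspCoeff_of_dvd_level`; Li 1975, Ogg 1969).

Since that reduction was written, inputs 3 and 4 have become **theorems of the tree**:
Rem. 4.5 is `rem45_isOdd_of` (`NewformGaloisRepOddProofs`: `det ρ = ε` by Lemme 3.2 and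
`ε(-1) = -1` in weight one) fed with the *unconditional* Lemme 3.2
`DeligneSerre1974.lemma32_complex_holds` (`ArtinRepFrobeniusProofs`, Frobenius' density theorem
in place of Chebotarev), and 1.8 is `IsNewform1.cuspCoeff_of_dvd_level_holds`
(`Gamma1NewformLSeriesProofs`, Atkin–Lehner–Li theory at a prime dividing the level).  Neither
discharge can be imported into `LanglandsTunnellLSeriesProofs` itself (both files import it), so
this companion file records the resulting **two-leaf form** of Thm. 4.6 (b):

* `DeligneSerre1974.rem45_isOdd_holds` — the discharge of the named fact `rem45_isOdd`
  (composition of the two theorems above; recorded under the fact's own name so that users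
  holding `(h : rem45_isOdd)` are fed it).
* `deligneSerre_eulerFactorAt_eq_of_dvd_level_of_functionalEquations''` — **Thm. 4.6 (b) at
  `p ∣ N` from (i) and (ii) alone**.
* `artinLFunction_eq_cuspFormLSeries_of_functionalEquations''` — `L(s, ρ) = L(s, f)` on
  `re s > 1` (`artinLFunction_eq_cuspFormLSeries` of `LanglandsTunnell`) from (i) and (ii) alone.
* `ModularForms.norm_cuspCoeff_le_card_divisors_weight_one_of''` — Thm. 9.1 (`|aₙ| ≤ d(n)`)
  from Thm. 4.1 (`DeligneSerre1974.thm41_exists`), (i) and (ii).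

So the trust base of `deligneSerre_eulerFactorAt_eq_of_dvd_level` (and of Thm. 4.6 (b)) is now
exactly the two functional equations (i), (ii); everything Deligne–Serre-specific (steps
(iii)–(iv), Lemme 4.9, the Euler products, the Hecke relations, Rem. 4.5, 1.8) is proved.  No
definition, no new named fact, nothing restated.

## References

* P. Deligne, J.-P. Serre, *Formes modulaires de poids 1*, Ann. Sci. ÉNS (4) 7 (1974),
  507–530, doi:10.24033/asens.1277 — Thm. 4.6 (p. 514) and its proof (i)–(iv), Lemme 4.9
  (pp. 515–516), Rem. 4.5 (p. 514), 1.8 (pp. 509–510), §9 Thm. 9.1 (`DeligneSerreASENS1974`).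
-/

noncomputable section

open scoped MatrixGroups ModularForm NumberField

open CongruenceSubgroup

/-! ### Rem. 4.5 discharged -/

namespace Literature.NumberTheory.EllipticCurves.ModularForms.DeligneSerre1974

variable {N : ℕ} [NeZero N]

/-- **Deligne–Serre 1974, Rem. 4.4–4.5 — discharge of the named fact `rem45_isOdd`.**  For a
weight-one newform `f ∈ S_1(Γ₁(N))` and a representation `ρ : Γ_ℚ → GL₂(ℂ)` with finite image
attached to `f` away from `N`, `ρ` is odd: `det ρ = ε` (Rem. 4.4, via Lemme 3.2) and
`ε(-1) = -1` (Rem. 4.5: "Du fait que `ε` est impair, 4.4 montre que `det(ρ(c)) = -1`").  This is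
`rem45_isOdd_of` (`NewformGaloisRepOddProofs`) fed with the unconditional Lemme 3.2
`Literature.NumberTheory.GaloisRepresentations.DeligneSerre1974.lemma32_complex_holds`
(`ArtinRepFrobeniusProofs`). [cite: DeligneSerreASENS1974, Rem. 4.4 and Rem. 4.5] -/
theorem rem45_isOdd_holds : rem45_isOdd (N := N) :=
  rem45_isOdd_of Literature.NumberTheory.GaloisRepresentations.DeligneSerre1974.lemma32_complex_holds

end Literature.NumberTheory.EllipticCurves.ModularForms.DeligneSerre1974

/-! ### Thm. 4.6 (b) at `p ∣ N` from the two functional equations -/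

namespace Literature.NumberTheory.Automorphic

open EllipticCurves.ModularForms ModularForms

variable {N : ℕ} [NeZero N] {f : CuspForm (Gamma1 N) 1}
  {ρ : GaloisRepresentations.FramedArtinRep ℚ 2}

/-- **Deligne–Serre 1974, Thm. 4.6 (b) at the primes dividing the level, from the two functional
equations alone.**  If (i) every weight-one newform satisfies the functional equation
`Λ_f(1 - s) = a Λ_{f̃}(s)` (`DeligneSerre1974.weightOne_functionalEquation`, op. cit. p. 515 (i),
after Li [12] and Miyake [13]) and (ii) every framed Artin representation of `Γ_ℚ` satisfies
Artin's functional equation `Λ(1 - s, ρ) = W Λ(s, ρ^∨)` (`artin_functional_equation (K := ℚ)`,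
op. cit. (ii), after Artin [1]), then for every weight-one newform `f` of level `N`, every `ρ`
attached to `f` away from `N` and every finite place `v` of `ℚ` above a prime `p ∣ N`, the Euler
factor `L_v(ρ, T)` is `1 - a_p T` (`deligneSerre_eulerFactorAt_eq_of_dvd_level`).  This is
`deligneSerre_eulerFactorAt_eq_of_dvd_level_of_functionalEquations'` with its inputs Rem. 4.5 and
1.8 discharged (`DeligneSerre1974.rem45_isOdd_holds`, `IsNewform1.cuspCoeff_of_dvd_level_holds`);
steps (iii)–(iv) and Lemme 4.9 of the printed proof are proved in
`LanglandsTunnellLSeriesProofs` and `FiniteEulerProducts`.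
[cite: DeligneSerreASENS1974, Thm. 4.6 (b) and its proof, (i)–(iv)] -/
theorem deligneSerre_eulerFactorAt_eq_of_dvd_level_of_functionalEquations''
    (hFEf : ∀ {N : ℕ} [NeZero N], DeligneSerre1974.weightOne_functionalEquation (N := N))
    (hFEρ : artin_functional_equation (K := ℚ)) :
    deligneSerre_eulerFactorAt_eq_of_dvd_level :=
  deligneSerre_eulerFactorAt_eq_of_dvd_level_of_functionalEquations' hFEf hFEρ
    (fun {_} _ ↦ DeligneSerre1974.rem45_isOdd_holds)
    (fun {_} _ ↦ IsNewform1.cuspCoeff_of_dvd_level_holds)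

/-- **`L(s, ρ) = L(s, f)` on `re s > 1` from the two functional equations alone** (Deligne–Serre
1974, Thm. 4.6 (b), whole proof): the named fact `artinLFunction_eq_cuspFormLSeries` of
`LanglandsTunnell` for a weight-one newform `f` and a representation `ρ` attached to it, from
(i) `DeligneSerre1974.weightOne_functionalEquation` and (ii) `artin_functional_equation (K := ℚ)`;
the rest of the printed proof (Thm. 4.1 at `p ∤ N`, steps (iii)–(iv), Lemme 4.9, Thm. 9.1 for the
region `re s > 1`, the Euler product (1.7.2), the Hecke relations, Rem. 4.5, 1.8) being theorems
of the tree (`artinLFunction_eq_cuspFormLSeries_of_hecke'`).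
[cite: DeligneSerreASENS1974, Thm. 4.6 (b)] -/
theorem artinLFunction_eq_cuspFormLSeries_of_functionalEquations''
    (hFEf : ∀ {N : ℕ} [NeZero N], DeligneSerre1974.weightOne_functionalEquation (N := N))
    (hFEρ : artin_functional_equation (K := ℚ)) :
    artinLFunction_eq_cuspFormLSeries (f := f) (ρ := ρ) :=
  artinLFunction_eq_cuspFormLSeries_of_hecke'
    (deligneSerre_eulerFactorAt_eq_of_dvd_level_of_functionalEquations'' hFEf hFEρ)

/-- **Thm. 9.1 (9.3) from Thm. 4.1 and the two functional equations**: the weight-one Ramanujan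
bound `|aₙ| ≤ d(n)` for all weight-one newforms (`norm_cuspCoeff_le_card_divisors_weight_one`)
from the existence of an attached finite-image representation (`DeligneSerre1974.thm41_exists`,
Thm. 4.1) and Thm. 4.6 (b) at `p ∣ N`, the latter from (i) and (ii)
(`norm_cuspCoeff_le_card_divisors_weight_one_of'`).
[cite: DeligneSerreASENS1974, §9 Thm. 9.1 and its proof] -/
theorem ModularForms.norm_cuspCoeff_le_card_divisors_weight_one_of''
    (h41 : ∀ {N : ℕ} [NeZero N], DeligneSerre1974.thm41_exists (N := N))
    (hFEf : ∀ {N : ℕ} [NeZero N], DeligneSerre1974.weightOne_functionalEquation (N := N))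
    (hFEρ : artin_functional_equation (K := ℚ)) :
    norm_cuspCoeff_le_card_divisors_weight_one :=
  norm_cuspCoeff_le_card_divisors_weight_one_of' h41
    (deligneSerre_eulerFactorAt_eq_of_dvd_level_of_functionalEquations'' hFEf hFEρ)

end Literature.NumberTheory.Automorphic

end
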